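import Mathlib
import Literature.RepresentationTheory.FiniteGroups.IrreducibleCharacters

/-!
# Stub `stub_wreathBudget` (line `Sketch`, crux `GradedDesignFamily`), part 1:
# the subgroup-index inequality for character-degree power sums

For finite groups `N`, `W`, an injective homomorphism `i : N →* W` of "index"
`I = |W| / |N|`, a real exponent `s ≥ 2` and sets of functions `S_W ⊆ ℂ^W`, `S_N ⊆ ℂ^N` such that
every irreducible constituent `ψ` of every restriction `χ ∘ i` (`χ ∈ Irr W ∩ S_W`) lies in `S_N`:

  `Σᶠ_{χ ∈ Irr W ∩ S_W} χ(1)^s ≤ I^{s-1} · Σᶠ_{ψ ∈ Irr N ∩ S_N} ψ(1)^s`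

(`wreathBudget_index_le`).  This is the graded, elementary form of Cohn–Kleinberg–Szegedy–Umans
2005, Lemma 7.2 (`d_s(H ≀ Sₙ) ≤ (n!)^{s-1} d_s(H)ⁿ`); no Clifford theory is used, only the regular
character on both groups (`Σ_χ χ(1) χ(w) = |W| [w = 1]`), the `ℕ`-valued multiplicities
`a_{χψ}` of the restrictions (`χ(1) = Σ_ψ a_{χψ} ψ(1)` and `Σ_χ a_{χψ} χ(1) = I ψ(1)`), and the
resulting bound `χ(1) ≤ I ψ(1)` for constituents.  The purely real-analytic part is isolated in
`wreathBudget_abstract`.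
-/

noncomputable section

set_option linter.dupNamespace false

open scoped BigOperators
open Literature.RepresentationTheory.FiniteGroups

namespace Summit.MatrixMultiplication.MatrixMultiplication.Theorems.GradedDesignFamily

/-- **The real-analytic core of the index inequality.**  Finite index sets `IW`, `IN`, "degrees"
`dW, dN ≥ 1`, multiplicities `a : IW × IN → ℕ` with `dW χ = Σ_ψ a χ ψ · dN ψ` (restriction) and
`Σ_χ a χ ψ · dW χ = I · dN ψ` (regular character), and predicates `pW`, `pN` such that
`a χ ψ ≠ 0`, `pW χ` force `pN ψ`; then for `s ≥ 2`,
`Σ_{χ, pW χ} dW χ ^ s ≤ I^{s-1} Σ_{ψ, pN ψ} dN ψ ^ s`.  (Write `dW^s = dW^{s-1} Σ_ψ a dN`, exchange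
the sums, and use `dW χ ≤ I dN ψ` whenever `a χ ψ ≥ 1`.)
[cite: CohnKleinbergSzegedyUmans2005, Lemma 7.2] -/
theorem wreathBudget_abstract {α β : Type*} (IW : Finset α) (IN : Finset β)
    (pW : α → Prop) (pN : β → Prop) [DecidablePred pW] [DecidablePred pN]
    (dW : α → ℝ) (dN : β → ℝ) (a : α → β → ℕ) (I s : ℝ) (hI : 0 < I) (hs : 2 ≤ s)
    (hdW : ∀ χ ∈ IW, 1 ≤ dW χ) (hdN : ∀ ψ ∈ IN, 1 ≤ dN ψ)
    (hR : ∀ χ ∈ IW, dW χ = ∑ ψ ∈ IN, (a χ ψ : ℝ) * dN ψ)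
    (hF : ∀ ψ ∈ IN, ∑ χ ∈ IW, (a χ ψ : ℝ) * dW χ = I * dN ψ)
    (hT : ∀ χ ∈ IW, pW χ → ∀ ψ ∈ IN, a χ ψ ≠ 0 → pN ψ) :
    ∑ χ ∈ IW.filter pW, dW χ ^ s ≤ I ^ (s - 1) * ∑ ψ ∈ IN.filter pN, dN ψ ^ s := by
  -- (1) `dW χ ^ s = dW χ ^ (s-1) · Σ_ψ a χ ψ dN ψ`, then exchange the sums
  have h1 : ∀ χ ∈ IW.filter pW,
      dW χ ^ s = ∑ ψ ∈ IN, dW χ ^ (s - 1) * ((a χ ψ : ℝ) * dN ψ) := by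
    intro χ hχ
    have hχW : χ ∈ IW := (Finset.mem_filter.1 hχ).1
    have h0 : dW χ ≠ 0 := (zero_lt_one.trans_le (hdW χ hχW)).ne'
    rw [← Finset.mul_sum, ← hR χ hχW, Real.rpow_sub_one h0, div_mul_cancel₀ _ h0]
  rw [Finset.sum_congr rfl h1, Finset.sum_comm]
  -- (2) only `ψ` with `pN ψ` contribute
  have hvan : ∀ ψ ∈ IN, ψ ∉ IN.filter pN →
      ∑ χ ∈ IW.filter pW, dW χ ^ (s - 1) * ((a χ ψ : ℝ) * dN ψ) = 0 := by
    intro ψ hψ hψ'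
    have hnot : ¬ pN ψ := fun h => hψ' (Finset.mem_filter.2 ⟨hψ, h⟩)
    refine Finset.sum_eq_zero fun χ hχ => ?_
    have hχ' := Finset.mem_filter.1 hχ
    have ha : a χ ψ = 0 := by
      by_contra ha
      exact hnot (hT χ hχ'.1 hχ'.2 ψ hψ ha)
    rw [ha, Nat.cast_zero, zero_mul, mul_zero]
  rw [← Finset.sum_subset (Finset.filter_subset pN IN) hvan, Finset.mul_sum]
  -- (3) termwise estimate in `ψ`
  refine Finset.sum_le_sum fun ψ hψ => ?_
  have hψN : ψ ∈ IN := (Finset.mem_filter.1 hψ).1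
  have hdN0 : 0 < dN ψ := zero_lt_one.trans_le (hdN ψ hψN)
  have hM : 0 < I * dN ψ := mul_pos hI hdN0
  have hterm : ∀ χ ∈ IW, dW χ ^ (s - 1) * ((a χ ψ : ℝ) * dN ψ) ≤
      (I * dN ψ) ^ (s - 2) * dN ψ * ((a χ ψ : ℝ) * dW χ) := by
    intro χ hχ
    have hd0 : 0 ≤ dW χ := zero_le_one.trans (hdW χ hχ)
    rcases Nat.eq_zero_or_pos (a χ ψ) with h0 | hpos
    · rw [h0, Nat.cast_zero, zero_mul, zero_mul, mul_zero, mul_zero]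
    · have hle : dW χ ≤ I * dN ψ := by
        calc dW χ ≤ (a χ ψ : ℝ) * dW χ := le_mul_of_one_le_left hd0 (by exact_mod_cast hpos)
          _ ≤ ∑ χ' ∈ IW, (a χ' ψ : ℝ) * dW χ' :=
              Finset.single_le_sum (f := fun χ' => (a χ' ψ : ℝ) * dW χ')
                (fun χ' hχ' => mul_nonneg (Nat.cast_nonneg _) (zero_le_one.trans (hdW χ' hχ')))
                hχ
          _ = I * dN ψ := hF ψ hψN
      have hpow : dW χ ^ (s - 1) ≤ (I * dN ψ) ^ (s - 2) * dW χ := by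
        rw [show s - 1 = (s - 2) + 1 by ring,
          Real.rpow_add_one (zero_lt_one.trans_le (hdW χ hχ)).ne']
        exact mul_le_mul_of_nonneg_right (Real.rpow_le_rpow hd0 hle (by linarith)) hd0
      calc dW χ ^ (s - 1) * ((a χ ψ : ℝ) * dN ψ)
          ≤ (I * dN ψ) ^ (s - 2) * dW χ * ((a χ ψ : ℝ) * dN ψ) :=
            mul_le_mul_of_nonneg_right hpow (mul_nonneg (Nat.cast_nonneg _) hdN0.le)
        _ = (I * dN ψ) ^ (s - 2) * dN ψ * ((a χ ψ : ℝ) * dW χ) := by ring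
  calc ∑ χ ∈ IW.filter pW, dW χ ^ (s - 1) * ((a χ ψ : ℝ) * dN ψ)
      ≤ ∑ χ ∈ IW, dW χ ^ (s - 1) * ((a χ ψ : ℝ) * dN ψ) :=
        Finset.sum_le_sum_of_subset_of_nonneg (Finset.filter_subset pW IW) fun χ hχ _ =>
          mul_nonneg (Real.rpow_nonneg (zero_le_one.trans (hdW χ hχ)) _)
            (mul_nonneg (Nat.cast_nonneg _) hdN0.le)
    _ ≤ ∑ χ ∈ IW, (I * dN ψ) ^ (s - 2) * dN ψ * ((a χ ψ : ℝ) * dW χ) := Finset.sum_le_sum hterm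
    _ = (I * dN ψ) ^ (s - 2) * dN ψ * (I * dN ψ) := by rw [← Finset.mul_sum, hF ψ hψN]
    _ = (I * dN ψ) ^ (s - 2) * (I * dN ψ) * dN ψ := by ring
    _ = (I * dN ψ) ^ (s - 1) * dN ψ := by
        rw [← Real.rpow_add_one hM.ne', show s - 2 + 1 = s - 1 by ring]
    _ = I ^ (s - 1) * (dN ψ ^ (s - 1) * dN ψ) := by
        rw [Real.mul_rpow hI.le hdN0.le, mul_assoc]
    _ = I ^ (s - 1) * dN ψ ^ s := by
        rw [← Real.rpow_add_one hdN0.ne', sub_add_cancel]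

/-- An irreducible character takes a positive integer value (the dimension) at `1`. [folklore] -/
theorem wreathBudget_exists_deg {G : Type} [Group G] {χ : G → ℂ} (h : IsIrrChar G χ) :
    ∃ d : ℕ, χ 1 = d ∧ 1 ≤ d := by
  obtain ⟨V, _, _, _, ρ, hρ, rfl⟩ := h
  haveI := hρ
  haveI : Nontrivial V := by
    by_contra hV
    rw [not_nontrivial_iff_subsingleton] at hV
    have hbt : (⊥ : Subrepresentation ρ) = ⊤ :=
      Subrepresentation.toSubmodule_injective (Subsingleton.elim _ _)
    exact (IsSimpleOrder.bot_ne_top (α := Subrepresentation ρ)) hbt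
  exact ⟨Module.finrank ℂ V, ρ.char_one, Module.finrank_pos⟩

/-- `1 ≤ χ(1)` (as a real number) for an irreducible character `χ`. [folklore] -/
theorem wreathBudget_one_le_re {G : Type} [Group G] {χ : G → ℂ} (h : IsIrrChar G χ) :
    (1 : ℝ) ≤ (χ 1).re := by
  obtain ⟨d, hd, h1⟩ := wreathBudget_exists_deg h
  rw [hd, Complex.natCast_re]
  exact_mod_cast h1

/-- The restriction of a character of `W` along a homomorphism `i : N →* W` is a character of `N`
(of the restricted representation `ρ ∘ i`). [folklore] -/
theorem wreathBudget_isCharacter_comp {N W : Type} [Group N] [Group W] (i : N →* W) {χ : W → ℂ}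
    (hχ : IsCharacter W χ) : IsCharacter N (fun n => χ (i n)) := by
  obtain ⟨V, _, _, _, ρ, rfl⟩ := hχ
  exact ⟨V, _, _, inferInstance, ρ.comp i, rfl⟩

/-- **The regular character, expanded in irreducible characters**:
`Σ_{χ ∈ Irr W} χ(1) χ(w) = |W| [w = 1]` (Serre §2.4, Prop. 5 and Cor. 1).
[cite: SerreLinearRepresentations1977, §2.4 Cor. 1] -/
theorem wreathBudget_sum_deg_mul_apply {W : Type} [Group W] [Fintype W] [DecidableEq W] (w : W) :
    ∑ χ ∈ (irrChars_finite_holds W).toFinset, χ 1 * χ w =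
      if w = 1 then (Fintype.card W : ℂ) else 0 := by
  have h := (isCharacter_leftRegular (G := W)).isClassFun.eq_sum_classInner_smul
  have hw := congrFun h w
  rw [Finset.sum_apply] at hw
  simp only [Pi.smul_apply, smul_eq_mul, classInner_leftRegular] at hw
  rw [← hw, character_leftRegular]

/-- **Regular character along an injective homomorphism**: for `i : N →* W` injective and any
`ψ : N → ℂ`, `Σ_{χ ∈ Irr W} χ(1) ⟨χ ∘ i, ψ⟩_N = (|W| / |N|) ψ(1)` (pair
`n ↦ Σ_χ χ(1) χ(i n) = |W| [n = 1]` with `ψ`). [cite: SerreLinearRepresentations1977, §2.4 Cor. 1] -/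
theorem wreathBudget_sum_deg_mul_classInner {N W : Type} [Group N] [Fintype N] [Group W]
    [Fintype W] (i : N →* W) (hi : Function.Injective i) (ψ : N → ℂ) :
    ∑ χ ∈ (irrChars_finite_holds W).toFinset, χ 1 * classInner (fun n => χ (i n)) ψ =
      (Fintype.card N : ℂ)⁻¹ * (Fintype.card W * ψ 1) := by
  classical
  have hfun : (fun n => ∑ χ ∈ (irrChars_finite_holds W).toFinset, χ 1 * χ (i n)) =
      fun n => if n = 1 then (Fintype.card W : ℂ) else 0 := by
    funext n
    rw [wreathBudget_sum_deg_mul_apply (i n)]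
    by_cases hn : n = 1
    · rw [if_pos hn, if_pos (by rw [hn, map_one])]
    · rw [if_neg hn, if_neg (fun h => hn ((map_eq_one_iff i hi).1 h))]
  have hlin : classInner (fun n => ∑ χ ∈ (irrChars_finite_holds W).toFinset, χ 1 * χ (i n)) ψ =
      ∑ χ ∈ (irrChars_finite_holds W).toFinset, χ 1 * classInner (fun n => χ (i n)) ψ := by
    have : (fun n => ∑ χ ∈ (irrChars_finite_holds W).toFinset, χ 1 * χ (i n)) =
        ∑ χ ∈ (irrChars_finite_holds W).toFinset, χ 1 • (fun n => χ (i n)) := by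
      funext n
      simp only [Finset.sum_apply, Pi.smul_apply, smul_eq_mul]
    rw [this, classInner_sum_left]
    refine Finset.sum_congr rfl fun χ _ => ?_
    rw [classInner_smul_left]
  rw [← hlin, hfun, classInner_apply]
  have hterm : ∀ t : N, (if t = 1 then (Fintype.card W : ℂ) else 0) * ψ t⁻¹ =
      if t = 1 then (Fintype.card W : ℂ) * ψ 1 else 0 := by
    intro t
    split_ifs with h
    · rw [h, inv_one]
    · rw [zero_mul]
  rw [Finset.sum_congr rfl fun t _ => hterm t, Finset.sum_ite_eq' Finset.univ (1 : N),
    if_pos (Finset.mem_univ _)]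

/-- **The subgroup-index inequality for graded character-degree power sums** (graded,
elementary form of Cohn–Kleinberg–Szegedy–Umans 2005, Lemma 7.2).  Let `i : N →* W` be an
injective homomorphism of finite groups, `I = |W| / |N|`, `s ≥ 2`, and `S_W ⊆ ℂ^W`, `S_N ⊆ ℂ^N`
such that every irreducible constituent `ψ` of `χ ∘ i`, for every `χ ∈ Irr W ∩ S_W`, lies in
`S_N`.  Then `Σᶠ_{χ ∈ Irr W ∩ S_W} χ(1)^s ≤ I^{s-1} Σᶠ_{ψ ∈ Irr N ∩ S_N} ψ(1)^s`.
Proof: with `a_{χψ} ∈ ℕ` the multiplicity of `ψ` in `χ ∘ i`, `χ(1) = Σ_ψ a_{χψ} ψ(1)` and, from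
the regular character of `W` restricted to `N`, `Σ_χ a_{χψ} χ(1) = I ψ(1)`; conclude with
`wreathBudget_abstract`. [cite: CohnKleinbergSzegedyUmans2005, Lemma 7.2] -/
theorem wreathBudget_index_le {N W : Type} [Group N] [Fintype N] [Group W] [Finite W]
    (i : N →* W) (hi : Function.Injective i) (SW : Set (W → ℂ)) (SN : Set (N → ℂ))
    (hT : ∀ χ ∈ irrChars W ∩ SW, ∀ ψ ∈ irrChars N,
      classInner (fun n => χ (i n)) ψ ≠ 0 → ψ ∈ SN)
    (s : ℝ) (hs : 2 ≤ s) :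
    ∑ᶠ χ ∈ irrChars W ∩ SW, (χ 1).re ^ s ≤
      ((Nat.card W : ℝ) / Nat.card N) ^ (s - 1) * ∑ᶠ ψ ∈ irrChars N ∩ SN, (ψ 1).re ^ s := by
  classical
  letI : Fintype W := Fintype.ofFinite W
  rw [Nat.card_eq_fintype_card, Nat.card_eq_fintype_card]
  set I : ℝ := (Fintype.card W : ℝ) / Fintype.card N with hI_def
  set IW := (irrChars_finite_holds W).toFinset with hIW
  set IN := (irrChars_finite_holds N).toFinset with hIN
  -- the `finsum`s are sums over filters of `IW`, `IN`
  have hfinW : (irrChars W ∩ SW).Finite := (irrChars_finite_holds W).subset Set.inter_subset_left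
  have hfinN : (irrChars N ∩ SN).Finite := (irrChars_finite_holds N).subset Set.inter_subset_left
  rw [finsum_mem_eq_finite_toFinset_sum _ hfinW, finsum_mem_eq_finite_toFinset_sum _ hfinN]
  have hWf : hfinW.toFinset = IW.filter (· ∈ SW) := by
    ext χ
    simp only [Set.Finite.mem_toFinset, Set.mem_inter_iff, Finset.mem_filter, hIW]
  have hNf : hfinN.toFinset = IN.filter (· ∈ SN) := by
    ext ψ
    simp only [Set.Finite.mem_toFinset, Set.mem_inter_iff, Finset.mem_filter, hIN]
  rw [hWf, hNf]
  -- multiplicities of the restrictions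
  have hmult : ∀ χ ∈ IW, ∃ m : Multiset (N → ℂ), (∀ ψ ∈ m, IsIrrChar N ψ) ∧
      (fun n => χ (i n)) = m.sum := fun χ hχ =>
    (wreathBudget_isCharacter_comp i
      ((irrChars_finite_holds W).mem_toFinset.mp hχ).isCharacter).exists_multiset_irrChars
  choose! m hm hmsum using hmult
  have hcnt : ∀ χ ∈ IW, ∀ ψ ∈ IN, classInner (fun n => χ (i n)) ψ = ((m χ).count ψ : ℂ) :=
    fun χ hχ ψ hψ => (congrArg (classInner · ψ) (hmsum χ hχ)).trans
      (classInner_multiset_sum_irrChars (hm χ hχ) ((irrChars_finite_holds N).mem_toFinset.mp hψ))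
  -- (R1) `χ(1) = Σ_ψ a_{χψ} ψ(1)`
  have hR : ∀ χ ∈ IW, (χ 1).re = ∑ ψ ∈ IN, (((m χ).count ψ : ℕ) : ℝ) * (ψ 1).re := by
    intro χ hχ
    have h := congrFun (hmsum χ hχ) 1
    simp only [map_one] at h
    rw [multiset_sum_apply, Finset.sum_multiset_map_count] at h
    have hsub : (m χ).toFinset ⊆ IN := fun ψ hψ =>
      (irrChars_finite_holds N).mem_toFinset.mpr (hm χ hχ ψ (Multiset.mem_toFinset.mp hψ))
    rw [Finset.sum_subset hsub (fun ψ _ hψ => by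
      rw [Multiset.count_eq_zero.mpr (fun h' => hψ (Multiset.mem_toFinset.mpr h')),
        zero_smul])] at h
    rw [congrArg Complex.re h, Complex.re_sum]
    refine Finset.sum_congr rfl fun ψ _ => ?_
    rw [nsmul_eq_mul, Complex.mul_re, Complex.natCast_re, Complex.natCast_im, zero_mul, sub_zero]
  -- (F1) `Σ_χ a_{χψ} χ(1) = I ψ(1)`
  have hF : ∀ ψ ∈ IN, ∑ χ ∈ IW, (((m χ).count ψ : ℕ) : ℝ) * (χ 1).re = I * (ψ 1).re := by
    intro ψ hψ
    have h := wreathBudget_sum_deg_mul_classInner i hi ψ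
    have h2 : ∑ χ ∈ IW, χ 1 * classInner (fun n => χ (i n)) ψ =
        ∑ χ ∈ IW, χ 1 * ((m χ).count ψ : ℂ) :=
      Finset.sum_congr rfl fun χ hχ => by rw [hcnt χ hχ ψ hψ]
    have h3 : (Fintype.card N : ℂ)⁻¹ * ((Fintype.card W : ℂ) * ψ 1) = ((I : ℝ) : ℂ) * ψ 1 := by
      rw [hI_def]
      push_cast
      ring
    rw [← hIW, h2, h3] at h
    rw [← Complex.re_ofReal_mul, ← h, Complex.re_sum]
    refine Finset.sum_congr rfl fun χ _ => ?_
    rw [Complex.mul_re, Complex.natCast_re, Complex.natCast_im, mul_zero, sub_zero, mul_comm]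
  -- the transfer hypothesis in terms of multiplicities
  have hT' : ∀ χ ∈ IW, χ ∈ SW → ∀ ψ ∈ IN, (m χ).count ψ ≠ 0 → ψ ∈ SN := by
    intro χ hχ hχS ψ hψ hne
    refine hT χ ⟨(irrChars_finite_holds W).mem_toFinset.mp hχ, hχS⟩ ψ
      ((irrChars_finite_holds N).mem_toFinset.mp hψ) fun h0 => ?_
    exact (Nat.cast_ne_zero.mpr hne : ((m χ).count ψ : ℂ) ≠ 0) ((hcnt χ hχ ψ hψ).symm.trans h0)
  have hIpos : 0 < I :=
    div_pos (Nat.cast_pos.mpr Fintype.card_pos) (Nat.cast_pos.mpr Fintype.card_pos)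
  exact wreathBudget_abstract IW IN (· ∈ SW) (· ∈ SN) (fun χ => (χ 1).re) (fun ψ => (ψ 1).re)
    (fun χ ψ => (m χ).count ψ) I s hIpos hs
    (fun χ hχ => wreathBudget_one_le_re ((irrChars_finite_holds W).mem_toFinset.mp hχ))
    (fun ψ hψ => wreathBudget_one_le_re ((irrChars_finite_holds N).mem_toFinset.mp hψ))
    hR hF hT'

end Summit.MatrixMultiplication.MatrixMultiplication.Theorems.GradedDesignFamily

end
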